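import Summits.QuantumFields.YangMills.Theorems.AlphaInputsT3ACv3ProfileBuildE
import Summits.QuantumFields.YangMills.Theorems.BalabanUVNodesN08AlphaProfileRegular
import HarnessLib

/-!
# `AlphaInputsT3ACv3ProfileRegularE` — STRATEGY B for 2′, (D6L)-CORE FORK, PART F5c′: THE CURL BOUND OF THE ENLARGED-REGION PROFILE — `|curl potZE| ≤ 2·amp j⋆` at a plaquette
# with a corner in `Ω′_{j⋆}(h)` and none of `y, y+e_μ, y+e_ν` in `Ω′_{j⋆+1}(h)` — hence `profE ∈ regClassC` AND the fine plaquettes of `profE` with a corner in `Ω′_i(h)` are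
# `½C68·a_i·L^{−2i}`-small (the near-reads smallness F5e′ needs) — lane `pub-balaban3d`, seat alpha-2 (g2)

WHAT (HOME `D6-AUDIT-alpha2-g2.md` §7, F5c′; twin of NODE O's `…N08AlphaProfileRegular` with `Ω ↦ Ω′ = ProfileEnlarged.OmegaE`, levels `≤ k`).  §1 the two-scale localisation of
the weights `wgtE` near a site of `Ω′_{j⋆}` outside `Ω′_{j⋆+1}` (KEY NESTING FACT of F4′ under the collar row (N2′) `CollarE`: `39·L + R0 + 8 ≤ rcolOf j`, `j + 1 ≤ k`); §2 ★
`abs_curl_potZE_le` (two-level bound `…Blend.abs_curl_blend_le` for `j⋆ < k`, exact locality `curl_blend_eq_of_local` for the top layer `j⋆ = k`); §3 ★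
`dist1_plaqVar_profE_le_of_corner` (a corner in `Ω′_i`, `i ≤ k` ⇒ `dist1 ≤ ½C68·a_i·L^{−2i}`), ★ `profE_mem_regClassC`.
HONEST FRAMING.  Kernel estimates for a CONSTRUCTED test configuration; nothing of [B10]∕[7]∕[4]'s estimates asserted; count-neutral helper toward R3 2′ (`stub_laneRecordsV3`, items
19935∕19936); nothing about d = 4, the continuum, or a mass gap.

References: T. Bałaban, Commun. Math. Phys. 102 (1985) 255–275 [Balaban1985UV3] ((38)–(39) p.266, (68) p.273); CMP 102 (1985) 277–309 [Balaban1985Variational] ((2)+(8) pp.278–279).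
-/

set_option autoImplicit false

noncomputable section

namespace Summit.QuantumFields.YangMills.Theorems.ProfileEnlarged

open scoped BigOperators Matrix.Norms.L2Operator
open NormedSpace
open Literature.MathematicalPhysics.QuantumFieldTheory.Balaban1983to89
open Literature.MathematicalPhysics.QuantumFieldTheory.Balaban1983to89.B10 (pFun)
open Literature.MathematicalPhysics.QuantumFieldTheory.Balaban1985CMP102
open Literature.MathematicalPhysics.QuantumFieldTheory.Balaban1985CMP102.Setting
open Summit.QuantumFields.Balaban3D.Carriers
open Summit.QuantumFields.Balaban3D.Proofs.Primitives (AlphaConsts)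
open Summit.QuantumFields.Balaban3D.Proofs.TorusLift (projSite projSite_add_e)
open Summit.QuantumFields.Balaban3D.Proofs.Run3Collar (tdist_shift_le)
open Summit.QuantumFields.YangMills.Theorems.BalabanUVNodesN08AlphaRegSel (plaqVar)
open Summit.QuantumFields.YangMills.Theorems.BalabanUVNodesN08AlphaCompactSel (regClassC)
open Summit.QuantumFields.YangMills.Theorems.BalabanUVNodesN08AlphaAbelianLift
open Summit.QuantumFields.YangMills.Theorems.BalabanUVNodesN08AlphaAbelianAverage
open Summit.QuantumFields.YangMills.Theorems.BalabanUVNodesN08AlphaPattern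
open Summit.QuantumFields.YangMills.Theorems.BalabanUVNodesN08AlphaHistGeom
open Summit.QuantumFields.YangMills.Theorems.BalabanUVNodesN08AlphaBlend
open Summit.QuantumFields.YangMills.Theorems.BalabanUVNodesN08AlphaProfileBuild (aj amp amp_nonneg amp_succ_le amp_antitone two_mul_amp_mul_norm R0 labZ projSite_labZ
  shift_comm)
open B3Taylor310LocalRemainder (tdist_comm tdist_triangle)
open B7Prop1Explicit (e e_apply)

variable {L : ℕ} (S : Scales L) {G : Type} [GaugeGroup G] [MeasurableSpace G] {𝔊 : GroupModel G} (𝔠 : AlphaConsts L 𝔊.N)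

/-! ## §1 The collar row (N2′) and the localisation of the weights -/

section Weights

variable {k : ℕ} (h : Hist S.P k)

/-- **THE COLLAR ROW (N2′)** of the enlarged construction: `39·L + R0 + 8 ≤ Rcol j` on the recorded scales (`R0 = 8`). [cite: Balaban1985UV3, (39) p.266] -/
def CollarE (k : ℕ) : Prop := ∀ j, j + 1 ≤ k → 39 * S.P.L + R0 + 8 ≤ rcolOf S 𝔠.lane.carrier j

/-- `θ′_j = 1` within distance `2` of the enlarged region `Ω′_j` (`j ≤ k`; `j = 0` or `Ω′_j ≠ ∅`). [folklore] -/
theorem ThetaE_eq_one_of_distToE_le_two {j : ℕ} (hjk : j ≤ k) {x : Site S.P 0} (hne : j = 0 ∨ (OmegaE 𝔠.lane.carrier.M₁ (rcolOf S 𝔠.lane.carrier) k h j).Nonempty)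
    (hx : distTo (OmegaE 𝔠.lane.carrier.M₁ (rcolOf S 𝔠.lane.carrier) k h j) x ≤ 2) :
    ThetaE 𝔠.lane.carrier.M₁ (rcolOf S 𝔠.lane.carrier) R0 h j x = 1 := by
  unfold ThetaE
  rw [if_neg (by omega)]
  split_ifs with hj0
  · rfl
  · exact theta_eq_one (hne.resolve_left hj0) (Nat.mul_pos (by norm_num [R0]) (pow_pos S.P.L_pos _)) hx

/-- **LOCALISATION (i)**: for `c ∈ Ω′_{j⋆}(h)` (`j⋆ ≤ k`) and `y` within fine distance `2` of `c`, `θ′_j(y) = 1` for every `j ≤ j⋆` (collars (N2′)). [folklore] -/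
theorem ThetaE_eq_one_of_nearE (hk : k ≤ S.P.m + S.P.K) (hR : CollarE S 𝔠 k) {js : ℕ} (hjs : js ≤ k) {c : Site S.P 0}
    (hc : c ∈ OmegaE 𝔠.lane.carrier.M₁ (rcolOf S 𝔠.lane.carrier) k h js) {y : Site S.P 0} (hy : Site.tdist c y ≤ 2) {j : ℕ} (hj : j ≤ js) :
    ThetaE 𝔠.lane.carrier.M₁ (rcolOf S 𝔠.lane.carrier) R0 h j y = 1 := by
  have h1 : ThetaE 𝔠.lane.carrier.M₁ (rcolOf S 𝔠.lane.carrier) R0 h js y = 1 :=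
    ThetaE_eq_one_of_distToE_le_two S 𝔠 h hjs (Or.inr ⟨c, hc⟩) ((distTo_le hc).trans (by rw [tdist_comm]; exact hy))
  have hanti := ThetaE_antitone 𝔠.lane.carrier.M₁ (rcolOf S 𝔠.lane.carrier) R0 h rfl hk (by norm_num [R0]) hR hj y
  have hle := (ThetaE_mem 𝔠.lane.carrier.M₁ (rcolOf S 𝔠.lane.carrier) R0 h j y).2
  linarith

/-- **LOCALISATION (ii)**: if `k ≤ j⋆` or `y ∉ Ω′_{j⋆+1}(h)`, then `θ′_j(y) = 0` for every `j ≥ j⋆ + 2` (collars (N2′); `Ω_{j⋆+1} ⊆ Ω′_{j⋆+1}`). [folklore] -/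
theorem ThetaE_eq_zero_of_nearE (hk : k ≤ S.P.m + S.P.K) (hR : CollarE S 𝔠 k) {js : ℕ} {y : Site S.P 0}
    (hy : k ≤ js ∨ y ∉ OmegaE 𝔠.lane.carrier.M₁ (rcolOf S 𝔠.lane.carrier) k h (js + 1)) {j : ℕ} (hj : js + 2 ≤ j) :
    ThetaE 𝔠.lane.carrier.M₁ (rcolOf S 𝔠.lane.carrier) R0 h j y = 0 := by
  have hR1 : 1 ≤ R0 := by norm_num [R0]
  have h2 : ThetaE 𝔠.lane.carrier.M₁ (rcolOf S 𝔠.lane.carrier) R0 h (js + 2) y = 0 := by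
    rcases hy with hk' | hy'
    · exact ThetaE_of_lt _ _ R0 h (by omega) y
    · by_cases hk2 : js + 2 ≤ k
      · have hy'' : y ∉ Omega 𝔠.lane.carrier.M₁ (rcolOf S 𝔠.lane.carrier) k h (js + 1) := fun hm => hy' (Omega_subset_OmegaE h _ hm)
        exact ThetaE_succ_eq_zero_of_bad _ _ R0 h rfl hk (show js + 1 + 1 ≤ k by omega) hR1 (hR (js + 1) (by omega)) (Or.inr hy'')
          (by rw [tdist_self']; omega)
      · exact ThetaE_of_lt _ _ R0 h (by omega) y
  have hanti := ThetaE_antitone 𝔠.lane.carrier.M₁ (rcolOf S 𝔠.lane.carrier) R0 h rfl hk hR1 hR hj y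
  have hge := (ThetaE_mem 𝔠.lane.carrier.M₁ (rcolOf S 𝔠.lane.carrier) R0 h j y).1
  linarith

/-- **Only the weights `j⋆, j⋆+1` survive near such a site.** [folklore] -/
theorem wgtE_eq_zero_of_nearE (hk : k ≤ S.P.m + S.P.K) (hR : CollarE S 𝔠 k) {js : ℕ} (hjs : js ≤ k) {c : Site S.P 0}
    (hc : c ∈ OmegaE 𝔠.lane.carrier.M₁ (rcolOf S 𝔠.lane.carrier) k h js) {y : Site S.P 0} (hy : Site.tdist c y ≤ 2)
    (hy' : k ≤ js ∨ y ∉ OmegaE 𝔠.lane.carrier.M₁ (rcolOf S 𝔠.lane.carrier) k h (js + 1)) {j : ℕ} (hj1 : j ≠ js) (hj2 : j ≠ js + 1) :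
    wgtE S 𝔠 h j y = 0 := by
  unfold wgtE
  rcases Nat.lt_or_gt_of_ne hj1 with hlt | hgt
  · rw [ThetaE_eq_one_of_nearE S 𝔠 h hk hR hjs hc hy hlt.le, ThetaE_eq_one_of_nearE S 𝔠 h hk hR hjs hc hy (by omega)]; ring
  · rw [ThetaE_eq_zero_of_nearE S 𝔠 h hk hR hy' (by omega), ThetaE_eq_zero_of_nearE S 𝔠 h hk hR hy' (by omega)]; ring

/-- The active weights in terms of `θ′_{j⋆+1}`. [folklore] -/
theorem wgtE_active_eq (hk : k ≤ S.P.m + S.P.K) (hR : CollarE S 𝔠 k) {js : ℕ} (hjs : js ≤ k) {c : Site S.P 0}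
    (hc : c ∈ OmegaE 𝔠.lane.carrier.M₁ (rcolOf S 𝔠.lane.carrier) k h js) {y : Site S.P 0} (hy : Site.tdist c y ≤ 2)
    (hy' : k ≤ js ∨ y ∉ OmegaE 𝔠.lane.carrier.M₁ (rcolOf S 𝔠.lane.carrier) k h (js + 1)) :
    wgtE S 𝔠 h js y = 1 - ThetaE 𝔠.lane.carrier.M₁ (rcolOf S 𝔠.lane.carrier) R0 h (js + 1) y ∧
    wgtE S 𝔠 h (js + 1) y = ThetaE 𝔠.lane.carrier.M₁ (rcolOf S 𝔠.lane.carrier) R0 h (js + 1) y := by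
  unfold wgtE
  rw [ThetaE_eq_one_of_nearE S 𝔠 h hk hR hjs hc hy le_rfl, ThetaE_eq_zero_of_nearE S 𝔠 h hk hR hy' le_rfl]
  exact ⟨rfl, sub_zero _⟩

/-- At the top layer (`j⋆ = k`) the weight `ω′_k` is `1` near a site of `Ω′_k`. [folklore] -/
theorem wgtE_top_eq_one (hk : k ≤ S.P.m + S.P.K) (hR : CollarE S 𝔠 k) {c : Site S.P 0}
    (hc : c ∈ OmegaE 𝔠.lane.carrier.M₁ (rcolOf S 𝔠.lane.carrier) k h k) {y : Site S.P 0} (hy : Site.tdist c y ≤ 2) : wgtE S 𝔠 h k y = 1 := by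
  unfold wgtE
  rw [ThetaE_eq_one_of_nearE S 𝔠 h hk hR le_rfl hc hy le_rfl, ThetaE_of_lt _ _ R0 h (Nat.lt_succ_self k)]; ring

end Weights

/-! ## §2 The curl bound of the enlarged-region potential -/

section Regular

variable {X : Matrix (Fin 𝔊.N) (Fin 𝔊.N) ℂ} {k : ℕ} (h : Hist S.P k)

/-- **★ THE CURL BOUND**: at a torus plaquette `(y; μ,ν)`, `μ ≠ ν`, with a corner in `Ω′_{j⋆}(h)` (`j⋆ ≤ k`) and — unless `j⋆ = k` — none of `y, y+e_μ, y+e_ν` in `Ω′_{j⋆+1}(h)`: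
`|curl potZE (lab y; μ,ν)| ≤ 2·amp j⋆` (`k ≤ K`, collars (N2′)).  Two-level bound of `…Blend` for `j⋆ < k`; exact locality at the top layer `j⋆ = k`. [folklore] -/
theorem abs_curl_potZE_le (hX0 : X ≠ 0) (hk : k ≤ S.K) (hR : CollarE S 𝔠 k) (y : Site S.P 0) {μ ν : Fin S.P.d} (hμν : μ ≠ ν) {js : ℕ} (hjs : js ≤ k)
    {c : Site S.P 0} (hc : c ∈ OmegaE 𝔠.lane.carrier.M₁ (rcolOf S 𝔠.lane.carrier) k h js)
    (hcor : c = y ∨ c = y.shift μ ∨ c = y.shift ν ∨ c = (y.shift μ).shift ν)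
    (hno : k ≤ js ∨ (y ∉ OmegaE 𝔠.lane.carrier.M₁ (rcolOf S 𝔠.lane.carrier) k h (js + 1) ∧
      y.shift μ ∉ OmegaE 𝔠.lane.carrier.M₁ (rcolOf S 𝔠.lane.carrier) k h (js + 1) ∧
      y.shift ν ∉ OmegaE 𝔠.lane.carrier.M₁ (rcolOf S 𝔠.lane.carrier) k h (js + 1))) :
    |curl (potZE S 𝔠 X h) (labZ y) μ ν| ≤ 2 * amp S 𝔠 X js := by
  have hkm : k ≤ S.P.m + S.P.K := le_trans hk (Nat.le_add_left _ _)
  have hLodd : Odd L := S.hL.1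
  have hL1 : 1 ≤ L := le_of_lt S.hL.2
  have hLr : (1 : ℝ) ≤ L := by exact_mod_cast hL1
  have hR1 : 1 ≤ R0 := by norm_num [R0]
  -- distances between the corners
  have hd1 : Site.tdist y (y.shift μ) ≤ 1 := tdist_shift_le y μ
  have hd2 : Site.tdist y (y.shift ν) ≤ 1 := tdist_shift_le y ν
  have hd3 : Site.tdist (y.shift μ) ((y.shift μ).shift ν) ≤ 1 := tdist_shift_le _ ν
  have hd4 : Site.tdist (y.shift ν) ((y.shift μ).shift ν) ≤ 1 := by rw [shift_comm y hμν]; exact tdist_shift_le _ μ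
  have hdμν : Site.tdist (y.shift μ) (y.shift ν) ≤ 2 :=
    (tdist_triangle _ y _).trans (add_le_add (by rw [tdist_comm]; exact hd1) hd2)
  have hn0 : Site.tdist c y ≤ 2 := by
    rcases hcor with h' | h' | h' | h' <;> rw [h']
    · rw [tdist_self']; omega
    · rw [tdist_comm]; omega
    · rw [tdist_comm]; omega
    · calc Site.tdist ((y.shift μ).shift ν) y ≤ Site.tdist ((y.shift μ).shift ν) (y.shift μ) + Site.tdist (y.shift μ) y := tdist_triangle _ _ _
        _ ≤ 1 + 1 := add_le_add (by rw [tdist_comm]; exact hd3) (by rw [tdist_comm]; exact hd1)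
  have hnμ : Site.tdist c (y.shift μ) ≤ 2 := by
    rcases hcor with h' | h' | h' | h' <;> rw [h']
    · omega
    · rw [tdist_self']; omega
    · rw [tdist_comm]; exact hdμν
    · rw [tdist_comm]; omega
  have hnν : Site.tdist c (y.shift ν) ≤ 2 := by
    rcases hcor with h' | h' | h' | h' <;> rw [h']
    · omega
    · exact hdμν
    · rw [tdist_self']; omega
    · rw [tdist_comm]; omega
  have hp0 : projSite (labZ y) = y := projSite_labZ y
  have hpμ : projSite (labZ y + e μ) = y.shift μ := by rw [projSite_add_e, projSite_labZ]
  have hpν : projSite (labZ y + e ν) = y.shift ν := by rw [projSite_add_e, projSite_labZ]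
  have hampjs : 0 ≤ amp S 𝔠 X js := amp_nonneg S 𝔠 hX0 (by omega)
  -- the top layer: exact locality (`ω′_k = 1`, all other weights `0` at the three points)
  rcases Nat.lt_or_ge js k with hlt | hge
  swap
  · have hjk : js = k := le_antisymm hjs hge
    subst hjk
    have hloc := curl_blend_eq_of_local (k := js + 1) (projSite (P := S.P)) (wgtE S 𝔠 h) (fun j => patPot (L ^ j) (amp S 𝔠 X j)) (labZ y) μ ν
      (j₀ := js) (Nat.lt_succ_self js)
      ⟨by rw [hp0]; exact wgtE_top_eq_one S 𝔠 h hkm hR hc hn0, by rw [hpμ]; exact wgtE_top_eq_one S 𝔠 h hkm hR hc hnμ,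
        by rw [hpν]; exact wgtE_top_eq_one S 𝔠 h hkm hR hc hnν⟩
      (fun j hj hne => ⟨by rw [hp0]; exact wgtE_eq_zero_of_nearE S 𝔠 h hkm hR le_rfl hc hn0 (Or.inl le_rfl) hne (by omega),
        by rw [hpμ]; exact wgtE_eq_zero_of_nearE S 𝔠 h hkm hR le_rfl hc hnμ (Or.inl le_rfl) hne (by omega),
        by rw [hpν]; exact wgtE_eq_zero_of_nearE S 𝔠 h hkm hR le_rfl hc hnν (Or.inl le_rfl) hne (by omega)⟩)
    show |curl (blend (js + 1) (projSite (P := S.P)) (wgtE S 𝔠 h) (fun j => patPot (L ^ j) (amp S 𝔠 X j))) (labZ y) μ ν| ≤ _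
    rw [hloc]
    refine (abs_curl_patPot_le (L ^ js) (hLodd.pow) _ _ μ ν).trans ?_
    rw [abs_of_nonneg hampjs]; linarith
  -- below the top: the two-level bound
  have hno0 : k ≤ js ∨ y ∉ OmegaE 𝔠.lane.carrier.M₁ (rcolOf S 𝔠.lane.carrier) k h (js + 1) := by
    rcases hno with hk' | ⟨h1, -, -⟩; exacts [Or.inl hk', Or.inr h1]
  have hnoμ : k ≤ js ∨ y.shift μ ∉ OmegaE 𝔠.lane.carrier.M₁ (rcolOf S 𝔠.lane.carrier) k h (js + 1) := by
    rcases hno with hk' | ⟨-, h2, -⟩; exacts [Or.inl hk', Or.inr h2]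
  have hnoν : k ≤ js ∨ y.shift ν ∉ OmegaE 𝔠.lane.carrier.M₁ (rcolOf S 𝔠.lane.carrier) k h (js + 1) := by
    rcases hno with hk' | ⟨-, -, h3⟩; exacts [Or.inl hk', Or.inr h3]
  set M : ℕ := L ^ js with hM
  have hM1 : (1 : ℝ) ≤ (M : ℝ) := by exact_mod_cast Nat.one_le_pow _ _ hL1
  have hamp1 : 0 ≤ amp S 𝔠 X (js + 1) := amp_nonneg S 𝔠 hX0 (by omega)
  have hampL : amp S 𝔠 X (js + 1) ≤ amp S 𝔠 X js / L := amp_succ_le S 𝔠 hX0 (by omega)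
  have key := abs_curl_blend_le (k := k + 1) (projSite (P := S.P)) (wgtE S 𝔠 h) (fun j => patPot (L ^ j) (amp S 𝔠 X j)) (labZ y) μ ν js
    (c := amp S 𝔠 X js) (δ := 1 / ((R0 * S.P.L ^ js : ℕ) : ℝ))
    (m := fun j => |amp S 𝔠 X j| * 2 * (((L : ℝ) ^ j + 1) / 2))
    hampjs (by positivity) (fun j => by positivity) ?_ ?_ ?_ ?_ ?_ ?_
  · refine (show |curl (potZE S 𝔠 X h) (labZ y) μ ν| = _ from rfl).trans_le (key.trans ?_)
    have hPL : S.P.L = L := rfl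
    rw [hPL, abs_of_nonneg hampjs, abs_of_nonneg hamp1]
    have hRM : ((R0 * L ^ js : ℕ) : ℝ) = 8 * (M : ℝ) := by rw [hM]; norm_num [R0]
    rw [hRM]
    have hM0 : (0 : ℝ) < M := by linarith
    have hL0 : (0 : ℝ) < L := by linarith
    have hLM : ((L : ℝ) ^ (js + 1) : ℝ) = L * M := by rw [hM, pow_succ]; push_cast; ring
    rw [show ((L : ℝ) ^ js) = (M : ℝ) by rw [hM]; push_cast; rfl, hLM]
    have h1 : amp S 𝔠 X (js + 1) * ((L : ℝ) * M + 1) ≤ amp S 𝔠 X js * ((M : ℝ) + 1) := by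
      calc amp S 𝔠 X (js + 1) * ((L : ℝ) * M + 1) ≤ (amp S 𝔠 X js / L) * ((L : ℝ) * M + 1) :=
            mul_le_mul_of_nonneg_right hampL (by positivity)
        _ = amp S 𝔠 X js * ((M : ℝ) + 1 / L) := by field_simp
        _ ≤ amp S 𝔠 X js * ((M : ℝ) + 1) := by
            refine mul_le_mul_of_nonneg_left ?_ hampjs
            have : 1 / (L : ℝ) ≤ 1 := by rw [div_le_one hL0]; exact hLr
            linarith
    have h2 : ((M : ℝ) + 1) / M ≤ 2 := by rw [div_le_iff₀ hM0]; linarith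
    calc amp S 𝔠 X js + 2 * (1 / (8 * (M : ℝ))) *
          (amp S 𝔠 X js * 2 * (((M : ℝ) + 1) / 2) + amp S 𝔠 X (js + 1) * 2 * (((L : ℝ) * M + 1) / 2))
        = amp S 𝔠 X js + (1 / (4 * (M : ℝ))) * (amp S 𝔠 X js * ((M : ℝ) + 1) + amp S 𝔠 X (js + 1) * ((L : ℝ) * M + 1)) := by
          ring
      _ ≤ amp S 𝔠 X js + (1 / (4 * (M : ℝ))) * (amp S 𝔠 X js * ((M : ℝ) + 1) + amp S 𝔠 X js * ((M : ℝ) + 1)) := by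
          gcongr
      _ = amp S 𝔠 X js + amp S 𝔠 X js * (((M : ℝ) + 1) / M) / 2 := by field_simp; ring
      _ ≤ amp S 𝔠 X js + amp S 𝔠 X js * 2 / 2 := by gcongr
      _ = 2 * amp S 𝔠 X js := by ring
  · intro j hj hj1 hj2
    exact ⟨by rw [hp0]; exact wgtE_eq_zero_of_nearE S 𝔠 h hkm hR hjs hc hn0 hno0 hj1 hj2,
      by rw [hpμ]; exact wgtE_eq_zero_of_nearE S 𝔠 h hkm hR hjs hc hnμ hnoμ hj1 hj2,
      by rw [hpν]; exact wgtE_eq_zero_of_nearE S 𝔠 h hkm hR hjs hc hnν hnoν hj1 hj2⟩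
  · intro j; exact wgtE_nonneg S 𝔠 h rfl hkm hR j _
  · exact sum_wgtE_le_one S 𝔠 h (k + 1) _
  · intro j hj
    have hW : ∀ y', Site.tdist y y' ≤ 1 →
        |ThetaE 𝔠.lane.carrier.M₁ (rcolOf S 𝔠.lane.carrier) R0 h (js + 1) y' - ThetaE 𝔠.lane.carrier.M₁ (rcolOf S 𝔠.lane.carrier) R0 h (js + 1) y| ≤
          1 / ((R0 * S.P.L ^ js : ℕ) : ℝ) := by
      intro y' hy'
      have hlip := abs_ThetaE_sub_le 𝔠.lane.carrier.M₁ (rcolOf S 𝔠.lane.carrier) R0 h hR1 (show 1 ≤ js + 1 by omega) y' y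
      rw [Nat.add_sub_cancel] at hlip
      refine hlip.trans (div_le_div_of_nonneg_right ?_ (by positivity))
      rw [tdist_comm]; exact_mod_cast hy'
    obtain ⟨a0, b0⟩ := wgtE_active_eq S 𝔠 h hkm hR hjs hc hn0 hno0
    obtain ⟨aμ, bμ⟩ := wgtE_active_eq S 𝔠 h hkm hR hjs hc hnμ hnoμ
    obtain ⟨aν, bν⟩ := wgtE_active_eq S 𝔠 h hkm hR hjs hc hnν hnoν
    rw [hp0, hpμ, hpν]
    rcases hj with hj | hj <;> rw [hj]
    · rw [a0, aμ, aν]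
      constructor
      · rw [show (1 - ThetaE _ _ R0 h (js + 1) (y.shift μ)) - (1 - ThetaE _ _ R0 h (js + 1) y) =
          -(ThetaE 𝔠.lane.carrier.M₁ (rcolOf S 𝔠.lane.carrier) R0 h (js + 1) (y.shift μ) - ThetaE _ _ R0 h (js + 1) y) by ring, abs_neg]
        exact hW _ hd1
      · rw [show (1 - ThetaE _ _ R0 h (js + 1) (y.shift ν)) - (1 - ThetaE _ _ R0 h (js + 1) y) =
          -(ThetaE 𝔠.lane.carrier.M₁ (rcolOf S 𝔠.lane.carrier) R0 h (js + 1) (y.shift ν) - ThetaE _ _ R0 h (js + 1) y) by ring, abs_neg]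
        exact hW _ hd2
    · rw [b0, bμ, bν]
      exact ⟨hW _ hd1, hW _ hd2⟩
  · intro j hj
    refine (abs_curl_patPot_le (L ^ j) (hLodd.pow) _ _ μ ν).trans ?_
    rcases hj with rfl | rfl
    · rw [abs_of_nonneg hampjs]
    · rw [abs_of_nonneg hamp1]
      exact hampL.trans (div_le_self hampjs hLr)
  · intro j _
    have hd3 : ((S.P.d : ℕ) : ℝ) - 1 = 2 := by norm_num [show S.P.d = 3 from rfl]
    have h1 := abs_patPot_le (L ^ j) (hLodd.pow) (amp S 𝔠 X j) (labZ y + e μ) ν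
    have h2 := abs_patPot_le (L ^ j) (hLodd.pow) (amp S 𝔠 X j) (labZ y + e ν) μ
    rw [hd3] at h1 h2
    push_cast at h1 h2
    exact ⟨h1, h2⟩

/-! ## §3 Fine plaquettes with a corner in an enlarged region; the closed regular class -/

variable (hX : X ∈ 𝔊.lie)

/-- **★ A FINE PLAQUETTE OF `profE` WITH A CORNER IN `Ω′_i(h)` (`i ≤ k`) IS `½C68·a_i·L^{−2i}`-SMALL** (`k ≤ K`, collars (N2′)): take `j⋆ ≥ i` the largest level `≤ k` with a corner in
`Ω′_{j⋆}`; the curl bound gives `2·amp j⋆·‖X‖ ≤ 2·amp i·‖X‖ = ½C68·a_i·L^{−2i}`. [cite: Balaban1985UV3, (68) p.273] -/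
theorem dist1_plaqVar_profE_le_of_corner (hX0 : X ≠ 0) (hk : k ≤ S.K) (hR : CollarE S 𝔠 k) (y : Site S.P 0) {μ ν : Fin S.P.d} (hμν : μ ≠ ν)
    {i : ℕ} (hi : i ≤ k)
    (hcor : y ∈ OmegaE 𝔠.lane.carrier.M₁ (rcolOf S 𝔠.lane.carrier) k h i ∨ y.shift μ ∈ OmegaE 𝔠.lane.carrier.M₁ (rcolOf S 𝔠.lane.carrier) k h i ∨
      y.shift ν ∈ OmegaE 𝔠.lane.carrier.M₁ (rcolOf S 𝔠.lane.carrier) k h i ∨ (y.shift μ).shift ν ∈ OmegaE 𝔠.lane.carrier.M₁ (rcolOf S 𝔠.lane.carrier) k h i) :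
    dist1 (plaqVar (profE S 𝔠 h hX) y μ ν) ≤ 𝔠.C68 / 2 * aj S 𝔠 i * (((L : ℝ) ^ i)⁻¹) ^ 2 := by
  classical
  have hkm : k ≤ S.P.m + S.P.K := le_trans hk (Nat.le_add_left _ _)
  set P : ℕ → Prop := fun j => y ∈ OmegaE 𝔠.lane.carrier.M₁ (rcolOf S 𝔠.lane.carrier) k h j ∨
    y.shift μ ∈ OmegaE 𝔠.lane.carrier.M₁ (rcolOf S 𝔠.lane.carrier) k h j ∨ y.shift ν ∈ OmegaE 𝔠.lane.carrier.M₁ (rcolOf S 𝔠.lane.carrier) k h j ∨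
    (y.shift μ).shift ν ∈ OmegaE 𝔠.lane.carrier.M₁ (rcolOf S 𝔠.lane.carrier) k h j with hPdef
  set js : ℕ := Nat.findGreatest P k with hjs_def
  have hjle : i ≤ js := Nat.le_findGreatest hi hcor
  have hjsk : js ≤ k := Nat.findGreatest_le k
  have hspec := Nat.findGreatest_eq_iff.1 hjs_def.symm
  have hPjs : P js := by
    by_cases hz : js = 0
    · have hi0 : i = 0 := by omega
      rw [hz, ← hi0]; exact hcor
    · exact hspec.2.1 hz
  have hno : k ≤ js ∨ (y ∉ OmegaE 𝔠.lane.carrier.M₁ (rcolOf S 𝔠.lane.carrier) k h (js + 1) ∧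
      y.shift μ ∉ OmegaE 𝔠.lane.carrier.M₁ (rcolOf S 𝔠.lane.carrier) k h (js + 1) ∧
      y.shift ν ∉ OmegaE 𝔠.lane.carrier.M₁ (rcolOf S 𝔠.lane.carrier) k h (js + 1)) := by
    by_cases hk1 : k ≤ js
    · exact Or.inl hk1
    · right
      have hnot : ¬ P (js + 1) := hspec.2.2 (Nat.lt_succ_self js) (by omega)
      simp only [hPdef, not_or] at hnot
      exact ⟨hnot.1, hnot.2.1, hnot.2.2.1⟩
  have hbound : |curl (potZE S 𝔠 X h) (labZ y) μ ν| ≤ 2 * amp S 𝔠 X js := by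
    rcases hPjs with hc | hc | hc | hc
    · exact abs_curl_potZE_le S 𝔠 h hX0 hk hR y hμν hjsk hc (Or.inl rfl) hno
    · exact abs_curl_potZE_le S 𝔠 h hX0 hk hR y hμν hjsk hc (Or.inr (Or.inl rfl)) hno
    · exact abs_curl_potZE_le S 𝔠 h hX0 hk hR y hμν hjsk hc (Or.inr (Or.inr (Or.inl rfl))) hno
    · exact abs_curl_potZE_le S 𝔠 h hX0 hk hR y hμν hjsk hc (Or.inr (Or.inr (Or.inr rfl))) hno
  calc dist1 (plaqVar (profE S 𝔠 h hX) y μ ν) ≤ |curl (potZE S 𝔠 X h) (labZ y) μ ν| * ‖X‖ := dist1_plaqVar_profE_le S 𝔠 h hX hkm y μ ν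
    _ ≤ 2 * amp S 𝔠 X js * ‖X‖ := mul_le_mul_of_nonneg_right hbound (norm_nonneg X)
    _ ≤ 2 * amp S 𝔠 X i * ‖X‖ := by
        have := amp_antitone S 𝔠 hX0 hjle (by omega)
        have hXn : 0 ≤ ‖X‖ := norm_nonneg X
        nlinarith
    _ = 𝔠.C68 / 2 * aj S 𝔠 i * (((L : ℝ) ^ i)⁻¹) ^ 2 := two_mul_amp_mul_norm S 𝔠 hX0 i

/-- **★ THE ENLARGED-REGION PROFILE LIES IN [7]'S CLOSED REGULAR CLASS** `regClassC 𝔊 𝔠 k h` (w.r.t. the ORIGINAL regions: a corner in `Ω_j(h) ⊆ Ω′_j(h)`; `k ≤ K`, collars (N2′)).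
[cite: Balaban1985Variational, (2)+(8) pp.278–279; Balaban1985UV3, (68) p.273] -/
theorem profE_mem_regClassC (hX0 : X ≠ 0) (hk : k ≤ S.K) (hR : CollarE S 𝔠 k) : profE S 𝔠 h hX ∈ regClassC 𝔊 𝔠 k h := by
  intro j hj y μ ν hμν hcor
  have hcor' : y ∈ OmegaE 𝔠.lane.carrier.M₁ (rcolOf S 𝔠.lane.carrier) k h j ∨ y.shift μ ∈ OmegaE 𝔠.lane.carrier.M₁ (rcolOf S 𝔠.lane.carrier) k h j ∨
      y.shift ν ∈ OmegaE 𝔠.lane.carrier.M₁ (rcolOf S 𝔠.lane.carrier) k h j ∨ (y.shift μ).shift ν ∈ OmegaE 𝔠.lane.carrier.M₁ (rcolOf S 𝔠.lane.carrier) k h j := by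
    rcases hcor with hc | hc | hc | hc
    · exact Or.inl (Omega_subset_OmegaE h _ hc)
    · exact Or.inr (Or.inl (Omega_subset_OmegaE h _ hc))
    · exact Or.inr (Or.inr (Or.inl (Omega_subset_OmegaE h _ hc)))
    · exact Or.inr (Or.inr (Or.inr (Omega_subset_OmegaE h _ hc)))
  exact dist1_plaqVar_profE_le_of_corner S 𝔠 h hX hX0 hk hR y hμν hj.le hcor'

end Regular

end Summit.QuantumFields.YangMills.Theorems.ProfileEnlarged

end
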